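import Literature.Probability.RandomPlanarGeometry.SLESixHullLocalityFact
import Literature.Probability.RandomPlanarGeometry.SLESixSplittingReduction
import Literature.Probability.RandomPlanarGeometry.SLESixMoebiusLocalityProofs
import Literature.Probability.RandomPlanarGeometry.SLEExistenceNeEightHolds
import Literature.Probability.RandomPlanarGeometry.StopAtShrinking
import HarnessLib

/-!
# Locality of chordal SLE₆, restriction form: the chain through a free auxiliary target

Topic `Probability/RandomPlanarGeometry`; theorems only. A step of the proof of the restriction
form of the locality of chordal SLE₆ (G. F. Lawler, O. Schramm, W. Werner, *Values of Brownian
intersection exponents I*, Acta Math. **187** (2001), Thm. 2.2 and Cor. 2.4; the tree's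
`IsSLELaw.locality_six`) for nested Dobrushin domains `D' ⊆ D` with common marked points
`a, b` in the case where the removed part `F = closure (D ∖ D')` reaches the target `b`
(`b ∈ F`, not covered by the printed hypothesis `a, b ∉ \bar I` of Cor. 2.4, i.e. by the
bounded clause `IsSLELaw.locality_six_bounded`). For a **free** boundary point
`t = ∂D(s) = ∂D'(u)` (`t ∉ F`, so `t` is a common boundary point near which `D = D'`):

* the bounded clause applies to the hull pair `(D; a, t) ⊇ (D'; a, t)` — the SLE₆ laws towards
  `t` agree once stopped on `F`;
* target independence (LSW Cor. 2.3, proved in the tree: `IsSLELaw.targetIndependence_six_of_moebius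
  sle_six_moebius_locality_holds`) in `(D; a, t, b)` and in `(D'; a, t, b)` — the laws towards
  `t` and towards `b` agree once stopped on the boundary arc between `t` and `b` not containing
  `a`, `A = ∂D[s, τ]` resp. `A' = ∂D'[u ∧ τ', u ∨ τ']`;
* each identity transfers to any closed stopping set containing its own
  (`measure_preimage_stopAt_eq_of_subset`: stopping twice),

so that (`IsSLELaw.measure_preimage_stopAt_eq_of_free`) **the SLE₆ laws of `(D; a, b)` and
`(D'; a, b)` agree once stopped on any closed `S ⊇ F ∪ A ∪ A'`**. Letting the free target tend
to the buried part and `S ↓ F` is done in `SLESixLocalityOfBounded.lean`.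

Both loops are assumed based at `a` (`mark 0 = 0`); the general case reduces to this by
re-basing the boundary parametrisations (an SLE law depends on the domain only through its
carrier and marked points, `IsSLELaw.of_carrier_eq`).

## References

* G. F. Lawler, O. Schramm, W. Werner, Acta Math. 187 (2001), Thm. 2.2, Cor. 2.3, Cor. 2.4.
  [LawlerSchrammWerner2001]
* W. Werner, *Lectures on two-dimensional critical percolation* (2007), Prop. 3.4. [Werner2007]
-/

noncomputable section

open Set Filter Topology MeasureTheory
open scoped NNReal

namespace Literature.Probability.RandomPlanarGeometry

namespace MarkedDomain

/-- For a marked domain based at parameter `0`, `pt 0 = boundary 0`. [folklore] -/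
theorem pt_zero_of_mark_zero {n : ℕ} [NeZero n] {D : MarkedDomain n} (h : D.mark 0 = 0) :
    D.pt 0 = D.boundary 0 := by
  rw [MarkedDomain.pt, h]

end MarkedDomain

/-! ### Target independence towards a boundary point given by its parameter -/

/-- **Target independence in `(D; a, ∂D s, b)` for a loop based at `a`** (`0 < s < mark 1`):
there is an SLE₆ law `ν` of the Dobrushin domain `(D; a, ∂D s)` (same carrier, `pt 0 = a`,
`pt 1 = D.boundary s`) whose classes stopped on the arc `∂D[s, mark 1]` have the same law as
those of the SLE₆ law `μ` of `(D; a, b)` (LSW Cor. 2.3 in the tree, Rohde–Schramm existence).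
[cite: LawlerSchrammWerner2001, Cor 2.3] -/
theorem IsSLELaw.exists_retarget_of_lt {D : DobrushinDomain} (hD : D.mark 0 = 0)
    {μ : Measure (CurveClass ℂ)} (hμ : IsSLELaw 6 D μ) {s : ℝ} (hs : s ∈ Ioo 0 (D.mark 1)) :
    ∃ (Ds : DobrushinDomain) (ν : Measure (CurveClass ℂ)), Ds.carrier = D.carrier ∧
      Ds.pt 0 = D.pt 0 ∧ Ds.pt 1 = D.boundary s ∧ IsSLELaw 6 Ds ν ∧
      ∀ T : Set (CurveClass ℂ), MeasurableSet T →
        ν (CurveClass.stopAt (D.boundary '' Icc s (D.mark 1)) ⁻¹' T) =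
          μ (CurveClass.stopAt (D.boundary '' Icc s (D.mark 1)) ⁻¹' T) := by
  have hm1 : D.mark 1 ∈ Ico (0 : ℝ) 1 := D.mark_mem 1
  let R : MarkedDomain 3 :=
    { toJordanDomain := D.toJordanDomain
      mark := ![0, s, D.mark 1]
      strictMono_mark := Fin.strictMono_iff_lt_succ.2 fun i ↦ by
        fin_cases i
        · show (0 : ℝ) < s; exact hs.1
        · show s < D.mark 1; exact hs.2
      mark_mem := fun i ↦ by
        fin_cases i
        · show (0 : ℝ) ∈ Ico (0 : ℝ) 1; exact ⟨le_rfl, one_pos⟩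
        · show s ∈ Ico (0 : ℝ) 1; exact ⟨hs.1.le, hs.2.trans hm1.2⟩
        · show D.mark 1 ∈ Ico (0 : ℝ) 1; exact hm1 }
  have hR0 : R.pt 0 = D.pt 0 := by
    rw [MarkedDomain.pt_zero_of_mark_zero hD]; rfl
  have hR1 : R.pt 1 = D.boundary s := rfl
  have hR2 : R.pt 2 = D.pt 1 := rfl
  have hRarc : R.arc 1 = D.boundary '' Icc s (D.mark 1) := by
    rw [MarkedDomain.arc, MarkedDomain.nextMark_of_lt R 1 (by decide)]; rfl
  -- `μ` is an SLE₆ law of `R.chord 0 2 = (D; a, b)`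
  have hμ₂ : IsSLELaw 6 (R.chord 0 2 (by decide)) μ := hμ.of_carrier_eq rfl hR0 hR2
  obtain ⟨ν, hν⟩ := exists_isSLELaw_of_ne_eight (κ := 6) (by norm_num) (by norm_num)
    (R.chord 0 1 (by decide))
  refine ⟨R.chord 0 1 (by decide), ν, rfl, hR0, hR1, hν, fun T hT ↦ ?_⟩
  rw [← hRarc]
  exact IsSLELaw.targetIndependence_six_of_moebius sle_six_moebius_locality_holds R hν hμ₂ T hT

/-- **Target independence in `(D; a, ∂D u, b)` or `(D; a, b, ∂D u)` for a loop based at `a`**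
(`0 < u < 1`, `u ≠ mark 1`): there is an SLE₆ law `ν` of `(D; a, ∂D u)` whose classes stopped
on the arc `∂D[u ∧ mark 1, u ∨ mark 1]` (between `∂D u` and `b`, not containing `a`) have the
same law as those of the SLE₆ law `μ` of `(D; a, b)`. [cite: LawlerSchrammWerner2001, Cor 2.3] -/
theorem IsSLELaw.exists_retarget {D : DobrushinDomain} (hD : D.mark 0 = 0)
    {μ : Measure (CurveClass ℂ)} (hμ : IsSLELaw 6 D μ) {u : ℝ} (hu : u ∈ Ioo (0 : ℝ) 1)
    (hum : u ≠ D.mark 1) :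
    ∃ (Du : DobrushinDomain) (ν : Measure (CurveClass ℂ)), Du.carrier = D.carrier ∧
      Du.pt 0 = D.pt 0 ∧ Du.pt 1 = D.boundary u ∧ IsSLELaw 6 Du ν ∧
      ∀ T : Set (CurveClass ℂ), MeasurableSet T →
        ν (CurveClass.stopAt (D.boundary '' Icc (min u (D.mark 1)) (max u (D.mark 1))) ⁻¹' T) =
          μ (CurveClass.stopAt (D.boundary '' Icc (min u (D.mark 1)) (max u (D.mark 1))) ⁻¹' T) := by
  have hm1 : D.mark 1 ∈ Ico (0 : ℝ) 1 := D.mark_mem 1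
  have hm01 : 0 < D.mark 1 := by
    have := D.strictMono_mark (show (0 : Fin 2) < 1 by decide)
    rwa [hD] at this
  rcases lt_or_gt_of_ne hum with hlt | hgt
  · rw [min_eq_left hlt.le, max_eq_right hlt.le]
    exact hμ.exists_retarget_of_lt hD ⟨hu.1, hlt⟩
  · rw [min_eq_right hgt.le, max_eq_left hgt.le]
    -- the rectangle `(D; a, b, ∂D u)`
    let R : MarkedDomain 3 :=
      { toJordanDomain := D.toJordanDomain
        mark := ![0, D.mark 1, u]
        strictMono_mark := Fin.strictMono_iff_lt_succ.2 fun i ↦ by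
          fin_cases i
          · show (0 : ℝ) < D.mark 1; exact hm01
          · show D.mark 1 < u; exact hgt
        mark_mem := fun i ↦ by
          fin_cases i
          · show (0 : ℝ) ∈ Ico (0 : ℝ) 1; exact ⟨le_rfl, one_pos⟩
          · show D.mark 1 ∈ Ico (0 : ℝ) 1; exact hm1
          · show u ∈ Ico (0 : ℝ) 1; exact ⟨hu.1.le, hu.2⟩ }
    have hR0 : R.pt 0 = D.pt 0 := by
      rw [MarkedDomain.pt_zero_of_mark_zero hD]; rfl
    have hR1 : R.pt 1 = D.pt 1 := rfl
    have hR2 : R.pt 2 = D.boundary u := rfl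
    have hRarc : R.arc 1 = D.boundary '' Icc (D.mark 1) u := by
      rw [MarkedDomain.arc, MarkedDomain.nextMark_of_lt R 1 (by decide)]; rfl
    have hμ₁ : IsSLELaw 6 (R.chord 0 1 (by decide)) μ := hμ.of_carrier_eq rfl hR0 hR1
    obtain ⟨ν, hν⟩ := exists_isSLELaw_of_ne_eight (κ := 6) (by norm_num) (by norm_num)
      (R.chord 0 2 (by decide))
    refine ⟨R.chord 0 2 (by decide), ν, rfl, hR0, hR2, hν, fun T hT ↦ ?_⟩
    rw [← hRarc]
    exact (IsSLELaw.targetIndependence_six_of_moebius sle_six_moebius_locality_holds R hμ₁ hν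
      T hT).symm

/-! ### The chain through a free target -/

/-- **The SLE₆ laws of `(D; a, b)` and of `(D'; a, b)` agree once stopped on any closed set
containing `F = closure (D ∖ D')` and the two boundary arcs from a free target to `b`.**
Here `D' ⊆ D` are Dobrushin domains with the same marked points `a = pt 0 ∉ F`, `b = pt 1`,
both loops based at `a`; `t = D.boundary s = D'.boundary u` is a *free* boundary point
(`t ∉ F`, `0 < s < D.mark 1`, `0 ≤ u < 1`); and the closed stopping set `S` contains `F`, the
arc `∂D[s, mark 1]` and the arc `∂D'[u ∧ mark 1, u ∨ mark 1]`. Chain: target independence in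
`D` (stop on the `∂D`-arc), the bounded clause of locality for the hull pair
`(D; a, t) ⊇ (D'; a, t)` (stop on `F`; hypothesis `hB`), target independence in `D'`
(stop on the `∂D'`-arc), each transferred to `S` by stopping twice.
[cite: LawlerSchrammWerner2001, Thm 2.2, Cor 2.3 and Cor 2.4] -/
theorem IsSLELaw.measure_preimage_stopAt_eq_of_free (hB : IsSLELaw.locality_six_bounded)
    {D D' : DobrushinDomain} (hD : D.mark 0 = 0) (hD' : D'.mark 0 = 0)
    {μ μ' : Measure (CurveClass ℂ)} (hμ : IsSLELaw 6 D μ) (hμ' : IsSLELaw 6 D' μ')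
    (hsub : D'.carrier ⊆ D.carrier) (h0 : D'.pt 0 = D.pt 0) (h1 : D'.pt 1 = D.pt 1)
    (ha : D.pt 0 ∉ closure (D.carrier \ D'.carrier))
    {s : ℝ} (hs : s ∈ Ioo 0 (D.mark 1)) (hfree : D.boundary s ∉ closure (D.carrier \ D'.carrier))
    {u : ℝ} (hu : u ∈ Ico (0 : ℝ) 1) (hut : D'.boundary u = D.boundary s)
    {S : Set ℂ} (hS : IsClosed S) (hFS : closure (D.carrier \ D'.carrier) ⊆ S)
    (hAS : D.boundary '' Icc s (D.mark 1) ⊆ S)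
    (hA'S : D'.boundary '' Icc (min u (D'.mark 1)) (max u (D'.mark 1)) ⊆ S)
    {T : Set (CurveClass ℂ)} (hT : MeasurableSet T) :
    μ' (CurveClass.stopAt S ⁻¹' T) = μ (CurveClass.stopAt S ⁻¹' T) := by
  set F : Set ℂ := closure (D.carrier \ D'.carrier) with hFdef
  have hm1 : D.mark 1 ∈ Ico (0 : ℝ) 1 := D.mark_mem 1
  have hm1' : D'.mark 1 ∈ Ico (0 : ℝ) 1 := D'.mark_mem 1
  have hs01 : s ∈ Ico (0 : ℝ) 1 := ⟨hs.1.le, hs.2.trans hm1.2⟩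
  have ha0 : D'.boundary 0 = D.boundary 0 := by
    rw [← MarkedDomain.pt_zero_of_mark_zero hD, ← MarkedDomain.pt_zero_of_mark_zero hD']; exact h0
  -- the `D'`-parameter `u` of the free point is neither that of `a` nor that of `b`
  have hu0 : u ≠ 0 := by
    rintro rfl
    rw [ha0] at hut
    exact hs.1.ne' (D.injOn_boundary hs01 ⟨le_rfl, one_pos⟩ hut.symm)
  have hum : u ≠ D'.mark 1 := by
    rintro rfl
    have hb : D.boundary s = D.boundary (D.mark 1) := by rw [← hut]; exact h1
    exact hs.2.ne (D.injOn_boundary hs01 hm1 hb)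
  have hu' : u ∈ Ioo (0 : ℝ) 1 := ⟨lt_of_le_of_ne hu.1 (Ne.symm hu0), hu.2⟩
  -- the three identities
  obtain ⟨Ds, ν, hDsc, hDs0, hDs1, hν, hTI⟩ := hμ.exists_retarget_of_lt hD hs
  obtain ⟨Dt, ν', hDtc, hDt0, hDt1, hν', hTI'⟩ := hμ'.exists_retarget hD' hu' hum
  have hHull : Ds.IsHullSubdomain Dt := by
    refine ⟨by rw [hDsc, hDtc]; exact hsub, by rw [hDt0, hDs0, h0], by rw [hDt1, hDs1, hut],
      ?_, ?_⟩
    · rw [hDsc, hDtc, hDs0]; exact ha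
    · rw [hDsc, hDtc, hDs1]; exact hfree
  have hLOC : ∀ T : Set (CurveClass ℂ), MeasurableSet T →
      ν' (CurveClass.stopAt F ⁻¹' T) = ν (CurveClass.stopAt F ⁻¹' T) := fun T hT ↦ by
    have := hB Ds Dt hν hν' hHull T hT
    rwa [hDsc, hDtc] at this
  -- closedness of the two arcs
  have hA : IsClosed (D.boundary '' Icc s (D.mark 1)) :=
    (isCompact_Icc.image D.continuous_boundary).isClosed
  have hA' : IsClosed (D'.boundary '' Icc (min u (D'.mark 1)) (max u (D'.mark 1))) :=
    (isCompact_Icc.image D'.continuous_boundary).isClosed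
  -- transfer to `S`
  have e1 : ν (CurveClass.stopAt S ⁻¹' T) = μ (CurveClass.stopAt S ⁻¹' T) :=
    measure_preimage_stopAt_eq_of_subset hA hS hAS hTI hT
  have e2 : ν' (CurveClass.stopAt S ⁻¹' T) = ν (CurveClass.stopAt S ⁻¹' T) :=
    measure_preimage_stopAt_eq_of_subset isClosed_closure hS hFS hLOC hT
  have e3 : ν' (CurveClass.stopAt S ⁻¹' T) = μ' (CurveClass.stopAt S ⁻¹' T) :=
    measure_preimage_stopAt_eq_of_subset hA' hS hA'S hTI' hT
  rw [← e3, e2, e1]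

end Literature.Probability.RandomPlanarGeometry

end
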